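import Mathlib.Analysis.SpecialFunctions.JapaneseBracket
import Mathlib.MeasureTheory.Integral.MeanInequalities
import Literature.Analysis.FluidPDE.TaoAveragedSobolevProofs
import Literature.Analysis.FluidPDE.TaoAveragedConjugation
import HarnessLib

/-!
# Tao's averaged Navier–Stokes setting: absolute convergence of the Euler form (1.3)

T. Tao, *Finite time blowup for an averaged three-dimensional Navier–Stokes equation*,
J. Amer. Math. Soc. **29** (2016), 601–674 = arXiv:1402.0290v3 (held as `paper:arxiv-1402.0290`),
§1.1, p. 3, (1.3)–(1.4): the Euler trilinear form
`⟨B(u,v), w⟩ = -πi ∫∫ Λ_{ξ₁,ξ₂,ξ₃}(û(ξ₁), v̂(ξ₂), ŵ(ξ₃)) dξ₁ dξ₂` (`ξ₃ = -ξ₁-ξ₂`), "for all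
`u, v, w ∈ H¹⁰_df`" (where the double integral converges absolutely), and p. 7: "the expectation
in (1.12) (or the integral in (1.13)) is absolutely convergent for any `u, v, w ∈ H¹⁰_df`".

Second support file of the discharge of the named fact
`Literature.Analysis.FluidPDE.Tao2016.complexAverage_linear_right` (`TaoAveragedComplexAverage.lean`).
With `eulerForm` the accepted Bochner-integral rendering of (1.3) (`TaoAveragedSobolev.lean`),
linearity of `w ↦ ⟨B(u,v), w⟩` needs the integrability of the `ℝ⁶`-integrand, which this file
quantifies:

* `norm_cdot_le`, `norm_Λ_le`, `enorm_Λ_le` — `|Λ_{ξ₁,ξ₂,ξ₃}(X₁,X₂,X₃)| ≤ (|X₁||ξ₂| + |X₂||ξ₁|)·|X₁ or X₂|·|X₃|`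
  (Cauchy–Schwarz for the bilinear dot product);
* `lintegral_mul_enorm_comp_sub_le` — `∫ A(ξ₂) |h(c - ξ₂)| dξ₂ ≤ ‖A‖₂ ‖h‖₂` (Cauchy–Schwarz and
  translation/reflection invariance of Lebesgue measure);
* `lintegral_enorm_Λ_le` — **the trilinear estimate**
  `∫∫ |Λ(f(ξ₁), g(ξ₂), h(-ξ₁-ξ₂))| ≤ (‖f‖₁ ‖|ξ|g‖₂ + ‖g‖₁ ‖|ξ|f‖₂) ‖h‖₂` (Tonelli);
* `lintegral_enorm_le_sobolevWeight` — `‖f‖₁ ≤ C (∫ (1+|ξ|²)^{10} |f|²)^{1/2}` with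
  `C = (∫_{ℝ³} (1+|ξ|²)^{-10})^{1/2} < ∞` (`lintegral_inv_sobolevWeight_lt_top`): `H¹⁰ ⊂ 𝓕L¹`
  (the weighted integral is `sobolevWeightIntegral` of the accepted `TaoAveragedConjugation.lean`);
* `Λ_add_smul_right`, `eulerForm_add_smul_right` — `Λ` is linear in `X₃`, and
  `⟨B(u,v), a w₁ + b w₂⟩ = a⟨B(u,v), w₁⟩ + b⟨B(u,v), w₂⟩` whenever the two integrands are
  integrable (e.g. `u, v ∈ H¹⁰`, `wᵢ ∈ L²`, by the estimates above).

## References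

* T. Tao, J. Amer. Math. Soc. 29 (2016), 601–674, arXiv:1402.0290v3, §1.1 (1.3)–(1.4) p. 3, p. 7.
  Key `Tao2016AveragedNS`.
-/

noncomputable section

open MeasureTheory Set Filter Complex FourierTransform
open scoped ENNReal NNReal

namespace Literature.Analysis.FluidPDE.Tao2016

/-! ### Pointwise bounds for `Λ` -/

/-- Cauchy–Schwarz for the complex bilinear dot product: `|a · b| ≤ ‖a‖ ‖b‖`. [folklore] -/
theorem norm_cdot_le (a b : EuclideanSpace ℂ (Fin 3)) : ‖cdot a b‖ ≤ ‖a‖ * ‖b‖ := by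
  unfold cdot
  calc ‖∑ i, a i * b i‖ ≤ ∑ i, ‖a i‖ * ‖b i‖ :=
        (norm_sum_le _ _).trans (le_of_eq (Finset.sum_congr rfl fun i _ => norm_mul _ _))
    _ ≤ √(∑ i, ‖a i‖ ^ 2) * √(∑ i, ‖b i‖ ^ 2) := Real.sum_mul_le_sqrt_mul_sqrt _ _ _
    _ = ‖a‖ * ‖b‖ := by rw [EuclideanSpace.norm_eq, EuclideanSpace.norm_eq]

/-- Pointwise bound for Tao's symbol (1.4):
`|Λ_{ξ₁,ξ₂,ξ₃}(X₁,X₂,X₃)| ≤ |X₁||ξ₂|·|X₂||X₃| + |X₂||ξ₁|·|X₁||X₃|`. [cite: Tao2016AveragedNS, (1.4)] -/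
theorem norm_Λ_le (ξ₁ ξ₂ : EuclideanSpace ℝ (Fin 3)) (X₁ X₂ X₃ : EuclideanSpace ℂ (Fin 3)) :
    ‖Λ ξ₁ ξ₂ X₁ X₂ X₃‖ ≤
      ‖X₁‖ * ‖ξ₂‖ * (‖X₂‖ * ‖X₃‖) + ‖X₂‖ * ‖ξ₁‖ * (‖X₁‖ * ‖X₃‖) := by
  unfold Λ
  refine (norm_add_le _ _).trans (add_le_add ?_ ?_)
  · rw [norm_mul]
    refine mul_le_mul ?_ (norm_cdot_le X₂ X₃) (norm_nonneg _) (by positivity)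
    simpa [FunctionSpaces.EuclideanSpace.norm_complexify] using
      norm_cdot_le X₁ (FunctionSpaces.EuclideanSpace.complexify ξ₂)
  · rw [norm_mul]
    refine mul_le_mul ?_ (norm_cdot_le X₁ X₃) (norm_nonneg _) (by positivity)
    simpa [FunctionSpaces.EuclideanSpace.norm_complexify] using
      norm_cdot_le X₂ (FunctionSpaces.EuclideanSpace.complexify ξ₁)

/-- The same bound in `ℝ≥0∞`. [cite: Tao2016AveragedNS, (1.4)] -/
theorem enorm_Λ_le (ξ₁ ξ₂ : EuclideanSpace ℝ (Fin 3)) (X₁ X₂ X₃ : EuclideanSpace ℂ (Fin 3)) :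
    ‖Λ ξ₁ ξ₂ X₁ X₂ X₃‖ₑ ≤
      ‖X₁‖ₑ * (‖ξ₂‖ₑ * ‖X₂‖ₑ) * ‖X₃‖ₑ + ‖X₂‖ₑ * (‖ξ₁‖ₑ * ‖X₁‖ₑ) * ‖X₃‖ₑ := by
  have h := norm_Λ_le ξ₁ ξ₂ X₁ X₂ X₃
  simp only [enorm_eq_nnnorm, ← ENNReal.coe_mul, ← ENNReal.coe_add, ENNReal.coe_le_coe]
  rw [← NNReal.coe_le_coe]
  push_cast [coe_nnnorm]
  convert h using 1
  ring

/-- `Λ` is linear in its third vector argument. [cite: Tao2016AveragedNS, (1.4)] -/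
theorem Λ_add_smul_right (ξ₁ ξ₂ : EuclideanSpace ℝ (Fin 3)) (X₁ X₂ X₃ Y₃ : EuclideanSpace ℂ (Fin 3))
    (a b : ℂ) :
    Λ ξ₁ ξ₂ X₁ X₂ (a • X₃ + b • Y₃) = a * Λ ξ₁ ξ₂ X₁ X₂ X₃ + b * Λ ξ₁ ξ₂ X₁ X₂ Y₃ := by
  unfold Λ
  rw [cdot_add_right, cdot_smul_right, cdot_smul_right, cdot_add_right, cdot_smul_right,
    cdot_smul_right]
  ring

/-! ### The trilinear estimate -/

/-- **Cauchy–Schwarz in the inner variable**: for `A ≥ 0` and a field `h`,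
`∫ A(ξ) |h(c - ξ)| dξ ≤ (∫ A²)^{1/2} (∫ |h|²)^{1/2}` (the substitution `ξ ↦ c - ξ` preserves
Lebesgue measure). [folklore] -/
theorem lintegral_mul_enorm_comp_sub_le {A : EuclideanSpace ℝ (Fin 3) → ℝ≥0∞}
    {h : EuclideanSpace ℝ (Fin 3) → EuclideanSpace ℂ (Fin 3)} (hA : AEMeasurable A volume)
    (hh : AEStronglyMeasurable h volume) (c : EuclideanSpace ℝ (Fin 3)) :
    ∫⁻ ξ, A ξ * ‖h (c - ξ)‖ₑ ≤
      (∫⁻ ξ, A ξ ^ 2) ^ (1 / 2 : ℝ) * (∫⁻ ξ, ‖h ξ‖ₑ ^ 2) ^ (1 / 2 : ℝ) := by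
  have hmp : MeasurePreserving (fun ξ : EuclideanSpace ℝ (Fin 3) => c - ξ) volume volume :=
    Measure.measurePreserving_sub_left volume c
  have hh' : AEMeasurable (fun ξ => ‖h (c - ξ)‖ₑ) volume :=
    (hh.comp_quasiMeasurePreserving hmp.quasiMeasurePreserving).enorm
  calc ∫⁻ ξ, A ξ * ‖h (c - ξ)‖ₑ
      ≤ (∫⁻ ξ, A ξ ^ (2 : ℝ)) ^ (1 / (2 : ℝ)) * (∫⁻ ξ, ‖h (c - ξ)‖ₑ ^ (2 : ℝ)) ^ (1 / (2 : ℝ)) :=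
        ENNReal.lintegral_mul_le_Lp_mul_Lq volume Real.HolderConjugate.two_two hA hh'
    _ = (∫⁻ ξ, A ξ ^ 2) ^ (1 / 2 : ℝ) * (∫⁻ ξ, ‖h ξ‖ₑ ^ 2) ^ (1 / 2 : ℝ) := by
        rw [lintegral_sub_left_eq_self (fun ξ => ‖h ξ‖ₑ ^ (2 : ℝ)) c]
        simp only [ENNReal.rpow_two]

/-- The relabelling `(ξ₁, ξ₂) ↦ ξ₃ = -ξ₁ - ξ₂` is quasi-measure-preserving `ℝ⁶ → ℝ³`. [folklore] -/
theorem quasiMeasurePreserving_neg_fst_sub_snd :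
    Measure.QuasiMeasurePreserving
      (fun p : EuclideanSpace ℝ (Fin 3) × EuclideanSpace ℝ (Fin 3) => -p.1 - p.2)
      ((volume : Measure (EuclideanSpace ℝ (Fin 3))).prod volume) volume :=
  (Measure.quasiMeasurePreserving_snd (μ := (volume : Measure (EuclideanSpace ℝ (Fin 3))))
    (ν := volume)).comp
    (measurePreserving_shear₂₃ (volume : Measure (EuclideanSpace ℝ (Fin 3)))).quasiMeasurePreserving

/-- **The trilinear estimate for the Euler form (1.3)**: for measurable fields `f, g, h` on
frequency space,
`∫∫ |Λ_{ξ₁,ξ₂,ξ₃}(f(ξ₁), g(ξ₂), h(ξ₃))| dξ₁dξ₂ ≤ (‖f‖₁ ‖|ξ|g‖₂ + ‖g‖₁ ‖|ξ|f‖₂) ‖h‖₂`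
(`ξ₃ = -ξ₁-ξ₂`; Tonelli, Cauchy–Schwarz in the inner variable, translation invariance). With
`f = û`, `g = v̂`, `h = ŵ` this is the absolute convergence of (1.3) for `u, v ∈ H¹⁰` (indeed
`H^s`, `s > 5/2`) and `w ∈ L²` (Tao, p. 3 and p. 7). [cite: Tao2016AveragedNS, §1.1 (1.3) p. 3] -/
theorem lintegral_enorm_Λ_le {f g h : EuclideanSpace ℝ (Fin 3) → EuclideanSpace ℂ (Fin 3)}
    (hf : AEStronglyMeasurable f volume) (hg : AEStronglyMeasurable g volume)
    (hh : AEStronglyMeasurable h volume) :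
    ∫⁻ p : EuclideanSpace ℝ (Fin 3) × EuclideanSpace ℝ (Fin 3),
        ‖Λ p.1 p.2 (f p.1) (g p.2) (h (-p.1 - p.2))‖ₑ ≤
      ((∫⁻ ξ, ‖f ξ‖ₑ) * (∫⁻ ξ, (‖ξ‖ₑ * ‖g ξ‖ₑ) ^ 2) ^ (1 / 2 : ℝ) +
        (∫⁻ ξ, ‖g ξ‖ₑ) * (∫⁻ ξ, (‖ξ‖ₑ * ‖f ξ‖ₑ) ^ 2) ^ (1 / 2 : ℝ)) *
        (∫⁻ ξ, ‖h ξ‖ₑ ^ 2) ^ (1 / 2 : ℝ) := by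
  rw [Measure.volume_eq_prod]
  set μ : Measure (EuclideanSpace ℝ (Fin 3)) := volume with hμ
  -- measurability of the pieces on the product space
  have hF : AEMeasurable (fun p : EuclideanSpace ℝ (Fin 3) × EuclideanSpace ℝ (Fin 3) =>
      ‖f p.1‖ₑ) (μ.prod μ) :=
    (hf.comp_quasiMeasurePreserving Measure.quasiMeasurePreserving_fst).enorm
  have hG : AEMeasurable (fun p : EuclideanSpace ℝ (Fin 3) × EuclideanSpace ℝ (Fin 3) =>
      ‖g p.2‖ₑ) (μ.prod μ) :=
    (hg.comp_quasiMeasurePreserving Measure.quasiMeasurePreserving_snd).enorm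
  have hH : AEMeasurable (fun p : EuclideanSpace ℝ (Fin 3) × EuclideanSpace ℝ (Fin 3) =>
      ‖h (-p.1 - p.2)‖ₑ) (μ.prod μ) :=
    (hh.comp_quasiMeasurePreserving quasiMeasurePreserving_neg_fst_sub_snd).enorm
  have hX1 : AEMeasurable (fun p : EuclideanSpace ℝ (Fin 3) × EuclideanSpace ℝ (Fin 3) =>
      ‖p.1‖ₑ) (μ.prod μ) := measurable_fst.enorm.aemeasurable
  have hX2 : AEMeasurable (fun p : EuclideanSpace ℝ (Fin 3) × EuclideanSpace ℝ (Fin 3) =>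
      ‖p.2‖ₑ) (μ.prod μ) := measurable_snd.enorm.aemeasurable
  -- the two Tonelli terms
  set T₁ : EuclideanSpace ℝ (Fin 3) × EuclideanSpace ℝ (Fin 3) → ℝ≥0∞ :=
    fun p => ‖f p.1‖ₑ * ((‖p.2‖ₑ * ‖g p.2‖ₑ) * ‖h (-p.1 - p.2)‖ₑ) with hT₁
  set T₂ : EuclideanSpace ℝ (Fin 3) × EuclideanSpace ℝ (Fin 3) → ℝ≥0∞ :=
    fun p => ‖g p.2‖ₑ * ((‖p.1‖ₑ * ‖f p.1‖ₑ) * ‖h (-p.1 - p.2)‖ₑ) with hT₂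
  have hT₁m : AEMeasurable T₁ (μ.prod μ) := hF.mul ((hX2.mul hG).mul hH)
  have hT₂m : AEMeasurable T₂ (μ.prod μ) := hG.mul ((hX1.mul hF).mul hH)
  set Wg : ℝ≥0∞ := (∫⁻ ξ, (‖ξ‖ₑ * ‖g ξ‖ₑ) ^ 2 ∂μ) ^ (1 / 2 : ℝ) with hWg
  set Wf : ℝ≥0∞ := (∫⁻ ξ, (‖ξ‖ₑ * ‖f ξ‖ₑ) ^ 2 ∂μ) ^ (1 / 2 : ℝ) with hWf
  set L2h : ℝ≥0∞ := (∫⁻ ξ, ‖h ξ‖ₑ ^ 2 ∂μ) ^ (1 / 2 : ℝ) with hL2h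
  -- first term: integrate `ξ₂` inside
  have h1 : ∫⁻ p, T₁ p ∂(μ.prod μ) ≤ (∫⁻ ξ, ‖f ξ‖ₑ ∂μ) * (Wg * L2h) := by
    rw [lintegral_prod _ hT₁m]
    calc ∫⁻ ξ₁, ∫⁻ ξ₂, T₁ (ξ₁, ξ₂) ∂μ ∂μ
        = ∫⁻ ξ₁, ‖f ξ₁‖ₑ * ∫⁻ ξ₂, (‖ξ₂‖ₑ * ‖g ξ₂‖ₑ) * ‖h (-ξ₁ - ξ₂)‖ₑ ∂μ ∂μ := by
          refine lintegral_congr fun ξ₁ => ?_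
          simp only [hT₁]
          rw [lintegral_const_mul' _ _ enorm_ne_top]
      _ ≤ ∫⁻ ξ₁, ‖f ξ₁‖ₑ * (Wg * L2h) ∂μ := by
          refine lintegral_mono fun ξ₁ => mul_le_mul' le_rfl ?_
          exact lintegral_mul_enorm_comp_sub_le (measurable_enorm.aemeasurable.mul hg.enorm)
            hh (-ξ₁)
      _ = (∫⁻ ξ, ‖f ξ‖ₑ ∂μ) * (Wg * L2h) := lintegral_mul_const'' _ hf.enorm
  -- second term: integrate `ξ₁` inside
  have h2 : ∫⁻ p, T₂ p ∂(μ.prod μ) ≤ (∫⁻ ξ, ‖g ξ‖ₑ ∂μ) * (Wf * L2h) := by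
    rw [lintegral_prod_symm _ hT₂m]
    calc ∫⁻ ξ₂, ∫⁻ ξ₁, T₂ (ξ₁, ξ₂) ∂μ ∂μ
        = ∫⁻ ξ₂, ‖g ξ₂‖ₑ * ∫⁻ ξ₁, (‖ξ₁‖ₑ * ‖f ξ₁‖ₑ) * ‖h (-ξ₂ - ξ₁)‖ₑ ∂μ ∂μ := by
          refine lintegral_congr fun ξ₂ => ?_
          simp only [hT₂]
          rw [lintegral_const_mul' _ _ enorm_ne_top]
          congr 1
          refine lintegral_congr fun ξ₁ => ?_
          rw [show -ξ₁ - ξ₂ = -ξ₂ - ξ₁ by abel]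
      _ ≤ ∫⁻ ξ₂, ‖g ξ₂‖ₑ * (Wf * L2h) ∂μ := by
          refine lintegral_mono fun ξ₂ => mul_le_mul' le_rfl ?_
          exact lintegral_mul_enorm_comp_sub_le (measurable_enorm.aemeasurable.mul hf.enorm)
            hh (-ξ₂)
      _ = (∫⁻ ξ, ‖g ξ‖ₑ ∂μ) * (Wf * L2h) := lintegral_mul_const'' _ hg.enorm
  calc ∫⁻ p, ‖Λ p.1 p.2 (f p.1) (g p.2) (h (-p.1 - p.2))‖ₑ ∂(μ.prod μ)
      ≤ ∫⁻ p, (T₁ p + T₂ p) ∂(μ.prod μ) := by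
        refine lintegral_mono fun p => ?_
        rw [hT₁, hT₂]
        convert enorm_Λ_le p.1 p.2 (f p.1) (g p.2) (h (-p.1 - p.2)) using 1
        ring
    _ = ∫⁻ p, T₁ p ∂(μ.prod μ) + ∫⁻ p, T₂ p ∂(μ.prod μ) := lintegral_add_left' hT₁m _
    _ ≤ (∫⁻ ξ, ‖f ξ‖ₑ ∂μ) * (Wg * L2h) + (∫⁻ ξ, ‖g ξ‖ₑ ∂μ) * (Wf * L2h) := add_le_add h1 h2
    _ = _ := by ring

/-! ### `H¹⁰ ⊂ 𝓕L¹`: the constant `(∫ (1+|ξ|²)^{-10})^{1/2}` -/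

/-- `∫_{ℝ³} (1+|ξ|²)^{-10} dξ < ∞` (Mathlib's `integrable_rpow_neg_one_add_norm_sq`, `20 > 3`). [folklore] -/
theorem lintegral_inv_sobolevWeight_lt_top :
    ∫⁻ ξ : EuclideanSpace ℝ (Fin 3), ENNReal.ofReal ((1 + ‖ξ‖ ^ 2) ^ (-10 : ℝ)) < ∞ := by
  have h := integrable_rpow_neg_one_add_norm_sq (E := EuclideanSpace ℝ (Fin 3))
    (μ := (volume : Measure (EuclideanSpace ℝ (Fin 3)))) (r := 20)
    (by rw [finrank_euclideanSpace, Fintype.card_fin]; norm_num)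
  have h' : Integrable (fun ξ : EuclideanSpace ℝ (Fin 3) => (1 + ‖ξ‖ ^ 2) ^ (-10 : ℝ)) := by
    refine h.congr (Eventually.of_forall fun ξ => ?_)
    norm_num
  exact h'.lintegral_lt_top

/-- The Sobolev weights multiply to one: `(1+|ξ|²)^{-5} (1+|ξ|²)^{5} = 1` in `ℝ≥0∞`. [folklore] -/
theorem ofReal_sobolevWeight_neg_mul (ξ : EuclideanSpace ℝ (Fin 3)) :
    ENNReal.ofReal ((1 + ‖ξ‖ ^ 2) ^ (-5 : ℝ)) * ENNReal.ofReal ((1 + ‖ξ‖ ^ 2) ^ (5 : ℝ)) = 1 := by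
  have h0 : 0 < 1 + ‖ξ‖ ^ 2 := by positivity
  rw [← ENNReal.ofReal_mul (Real.rpow_nonneg h0.le _), ← Real.rpow_add h0]
  norm_num

/-- **`H¹⁰(ℝ³) ⊂ 𝓕L¹`**: `∫ |f| ≤ (∫ (1+|ξ|²)^{-10})^{1/2} (∫ (1+|ξ|²)^{10} |f(ξ)|² dξ)^{1/2}`
(Cauchy–Schwarz); applied to `f = û` the second factor is `‖u‖_{H¹⁰}`. [folklore] -/
theorem lintegral_enorm_le_sobolevWeight {f : EuclideanSpace ℝ (Fin 3) → EuclideanSpace ℂ (Fin 3)}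
    (hf : AEStronglyMeasurable f volume) :
    ∫⁻ ξ, ‖f ξ‖ₑ ≤
      (∫⁻ ξ : EuclideanSpace ℝ (Fin 3), ENNReal.ofReal ((1 + ‖ξ‖ ^ 2) ^ (-10 : ℝ))) ^ (1 / 2 : ℝ) *
        sobolevWeightIntegral 10 f ^ (1 / 2 : ℝ) := by
  have hw : ∀ s : ℝ, Measurable fun ξ : EuclideanSpace ℝ (Fin 3) =>
      ENNReal.ofReal ((1 + ‖ξ‖ ^ 2) ^ s) := measurable_sobolevWeight
  unfold sobolevWeightIntegral
  have hsq : ∀ (s : ℝ) (ξ : EuclideanSpace ℝ (Fin 3)),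
      ENNReal.ofReal ((1 + ‖ξ‖ ^ 2) ^ s) ^ (2 : ℝ) = ENNReal.ofReal ((1 + ‖ξ‖ ^ 2) ^ (2 * s)) := by
    intro s ξ
    have h0 : 0 < 1 + ‖ξ‖ ^ 2 := by positivity
    rw [ENNReal.ofReal_rpow_of_nonneg (Real.rpow_nonneg h0.le _) (by norm_num), ← Real.rpow_mul h0.le,
      mul_comm]
  calc ∫⁻ ξ, ‖f ξ‖ₑ
      = ∫⁻ ξ, ENNReal.ofReal ((1 + ‖ξ‖ ^ 2) ^ (-5 : ℝ)) *
          (ENNReal.ofReal ((1 + ‖ξ‖ ^ 2) ^ (5 : ℝ)) * ‖f ξ‖ₑ) := by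
        refine lintegral_congr fun ξ => ?_
        rw [← mul_assoc, ofReal_sobolevWeight_neg_mul, one_mul]
    _ ≤ (∫⁻ ξ, ENNReal.ofReal ((1 + ‖ξ‖ ^ 2) ^ (-5 : ℝ)) ^ (2 : ℝ)) ^ (1 / (2 : ℝ)) *
          (∫⁻ ξ, (ENNReal.ofReal ((1 + ‖ξ‖ ^ 2) ^ (5 : ℝ)) * ‖f ξ‖ₑ) ^ (2 : ℝ)) ^ (1 / (2 : ℝ)) :=
        ENNReal.lintegral_mul_le_Lp_mul_Lq volume Real.HolderConjugate.two_two (hw _).aemeasurable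
          ((hw _).aemeasurable.mul hf.enorm)
    _ = _ := by
        congr 2
        · refine lintegral_congr fun ξ => ?_
          rw [hsq]
          norm_num
        · refine lintegral_congr fun ξ => ?_
          rw [ENNReal.mul_rpow_of_nonneg _ _ (by norm_num : (0 : ℝ) ≤ 2), hsq, ENNReal.rpow_two]
          norm_num

/-! ### Linearity of the Euler form in `w` -/

/-- The Fourier representative of a linear combination: `𝓕(a w₁ + b w₂) = a ŵ₁ + b ŵ₂` a.e. [folklore] -/
theorem fourierFn_add_smul (a b : ℂ) (w₁ w₂ : L2C) :
    fourierFn (a • w₁ + b • w₂) =ᵐ[volume] fun ξ => a • fourierFn w₁ ξ + b • fourierFn w₂ ξ := by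
  unfold fourierFn
  rw [FourierTransform.fourier_add, FourierTransform.fourier_smul, FourierTransform.fourier_smul]
  filter_upwards [Lp.coeFn_add (a • (𝓕 w₁ : L2C)) (b • (𝓕 w₂ : L2C)), Lp.coeFn_smul a (𝓕 w₁ : L2C),
    Lp.coeFn_smul b (𝓕 w₂ : L2C)] with ξ h1 h2 h3
  rw [h1, Pi.add_apply, h2, h3, Pi.smul_apply, Pi.smul_apply]

/-- **The Euler form is linear in `w` where (1.3) converges absolutely**: if the integrands
`(ξ₁,ξ₂) ↦ Λ(û(ξ₁), v̂(ξ₂), ŵᵢ(-ξ₁-ξ₂))`, `i = 1, 2`, are integrable on `ℝ³ × ℝ³`, then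
`⟨B(u,v), a w₁ + b w₂⟩ = a ⟨B(u,v), w₁⟩ + b ⟨B(u,v), w₂⟩` (Tao defines `B(u,v) ∈ (H¹⁰_df)*` by
duality, p. 3; here for the Bochner rendering `eulerForm`). [cite: Tao2016AveragedNS, §1.1 (1.3) p. 3] -/
theorem eulerForm_add_smul_right {u v w₁ w₂ : L2C} (a b : ℂ)
    (h₁ : Integrable (fun p : EuclideanSpace ℝ (Fin 3) × EuclideanSpace ℝ (Fin 3) =>
      Λ p.1 p.2 (fourierFn u p.1) (fourierFn v p.2) (fourierFn w₁ (-p.1 - p.2))))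
    (h₂ : Integrable (fun p : EuclideanSpace ℝ (Fin 3) × EuclideanSpace ℝ (Fin 3) =>
      Λ p.1 p.2 (fourierFn u p.1) (fourierFn v p.2) (fourierFn w₂ (-p.1 - p.2)))) :
    eulerForm u v (a • w₁ + b • w₂) = a * eulerForm u v w₁ + b * eulerForm u v w₂ := by
  unfold eulerForm
  have hae : (fun p : EuclideanSpace ℝ (Fin 3) × EuclideanSpace ℝ (Fin 3) =>
      Λ p.1 p.2 (fourierFn u p.1) (fourierFn v p.2) (fourierFn (a • w₁ + b • w₂) (-p.1 - p.2))) =ᵐ[volume]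
      fun p => a * Λ p.1 p.2 (fourierFn u p.1) (fourierFn v p.2) (fourierFn w₁ (-p.1 - p.2)) +
        b * Λ p.1 p.2 (fourierFn u p.1) (fourierFn v p.2) (fourierFn w₂ (-p.1 - p.2)) := by
    have h := quasiMeasurePreserving_neg_fst_sub_snd.ae_eq (fourierFn_add_smul a b w₁ w₂)
    rw [Measure.volume_eq_prod]
    filter_upwards [h] with p hp
    simp only [Function.comp_apply] at hp
    rw [hp, Λ_add_smul_right]
  rw [integral_congr_ae hae, integral_add (h₁.const_mul a) (h₂.const_mul b), integral_const_mul,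
    integral_const_mul]
  ring

/-! ### Integrability of the Euler integrand for `u, v ∈ H¹⁰`, `w ∈ L²` -/

/-- The bilinear dot product is continuous. [folklore] -/
theorem continuous_cdot :
    Continuous (fun q : EuclideanSpace ℂ (Fin 3) × EuclideanSpace ℂ (Fin 3) => cdot q.1 q.2) := by
  unfold cdot
  fun_prop

/-- Tao's symbol `Λ` (1.4) is continuous in all five arguments. [cite: Tao2016AveragedNS, (1.4)] -/
theorem continuous_Λ :
    Continuous (fun q : (EuclideanSpace ℝ (Fin 3) × EuclideanSpace ℝ (Fin 3)) ×
        (EuclideanSpace ℂ (Fin 3) × EuclideanSpace ℂ (Fin 3) × EuclideanSpace ℂ (Fin 3)) =>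
      Λ q.1.1 q.1.2 q.2.1 q.2.2.1 q.2.2.2) := by
  have hc := FunctionSpaces.EuclideanSpace.continuous_complexify (ι := Fin 3)
  unfold Λ
  refine ((continuous_cdot.comp (Continuous.prodMk (by fun_prop) (hc.comp (by fun_prop)))).mul
    (continuous_cdot.comp (Continuous.prodMk (by fun_prop) (by fun_prop)))).add
    ((continuous_cdot.comp (Continuous.prodMk (by fun_prop) (hc.comp (by fun_prop)))).mul
    (continuous_cdot.comp (Continuous.prodMk (by fun_prop) (by fun_prop))))

/-- The Euler integrand `(ξ₁,ξ₂) ↦ Λ(f(ξ₁), g(ξ₂), h(-ξ₁-ξ₂))` is a.e. strongly measurable on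
`ℝ³ × ℝ³` for a.e. strongly measurable `f, g, h`. [folklore] -/
theorem aestronglyMeasurable_Λ_comp {f g h : EuclideanSpace ℝ (Fin 3) → EuclideanSpace ℂ (Fin 3)}
    (hf : AEStronglyMeasurable f volume) (hg : AEStronglyMeasurable g volume)
    (hh : AEStronglyMeasurable h volume) :
    AEStronglyMeasurable (fun p : EuclideanSpace ℝ (Fin 3) × EuclideanSpace ℝ (Fin 3) =>
      Λ p.1 p.2 (f p.1) (g p.2) (h (-p.1 - p.2))) volume := by
  rw [Measure.volume_eq_prod]
  have hF : AEStronglyMeasurable (fun p : EuclideanSpace ℝ (Fin 3) × EuclideanSpace ℝ (Fin 3) =>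
      f p.1) ((volume : Measure (EuclideanSpace ℝ (Fin 3))).prod volume) :=
    hf.comp_quasiMeasurePreserving Measure.quasiMeasurePreserving_fst
  have hG : AEStronglyMeasurable (fun p : EuclideanSpace ℝ (Fin 3) × EuclideanSpace ℝ (Fin 3) =>
      g p.2) ((volume : Measure (EuclideanSpace ℝ (Fin 3))).prod volume) :=
    hg.comp_quasiMeasurePreserving Measure.quasiMeasurePreserving_snd
  have hH : AEStronglyMeasurable (fun p : EuclideanSpace ℝ (Fin 3) × EuclideanSpace ℝ (Fin 3) =>
      h (-p.1 - p.2)) ((volume : Measure (EuclideanSpace ℝ (Fin 3))).prod volume) :=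
    hh.comp_quasiMeasurePreserving quasiMeasurePreserving_neg_fst_sub_snd
  have hq : AEStronglyMeasurable (fun p : EuclideanSpace ℝ (Fin 3) × EuclideanSpace ℝ (Fin 3) =>
      (p, (f p.1, g p.2, h (-p.1 - p.2)))) ((volume : Measure (EuclideanSpace ℝ (Fin 3))).prod volume) :=
    aestronglyMeasurable_id.prodMk (hF.prodMk (hG.prodMk hH))
  have heq : (fun p : EuclideanSpace ℝ (Fin 3) × EuclideanSpace ℝ (Fin 3) =>
      Λ p.1 p.2 (f p.1) (g p.2) (h (-p.1 - p.2))) =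
      (fun q : (EuclideanSpace ℝ (Fin 3) × EuclideanSpace ℝ (Fin 3)) ×
        (EuclideanSpace ℂ (Fin 3) × EuclideanSpace ℂ (Fin 3) × EuclideanSpace ℂ (Fin 3)) =>
        Λ q.1.1 q.1.2 q.2.1 q.2.2.1 q.2.2.2) ∘
      (fun p : EuclideanSpace ℝ (Fin 3) × EuclideanSpace ℝ (Fin 3) =>
        (p, (f p.1, g p.2, h (-p.1 - p.2)))) := rfl
  rw [heq]
  exact continuous_Λ.comp_aestronglyMeasurable hq

/-- `‖|ξ| f‖₂ ≤ (∫ (1+|ξ|²)^{10} |f|²)^{1/2}`: the first-moment weight is dominated by the `H¹⁰`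
weight. [folklore] -/
theorem lintegral_sq_enorm_mul_rpow_le (f : EuclideanSpace ℝ (Fin 3) → EuclideanSpace ℂ (Fin 3)) :
    (∫⁻ ξ, (‖ξ‖ₑ * ‖f ξ‖ₑ) ^ 2) ^ (1 / 2 : ℝ) ≤ sobolevWeightIntegral 10 f ^ (1 / 2 : ℝ) := by
  unfold sobolevWeightIntegral
  refine ENNReal.rpow_le_rpow (lintegral_mono fun ξ => ?_) (by norm_num)
  rw [mul_pow]
  refine mul_le_mul' ?_ le_rfl
  rw [← ofReal_norm, ← ENNReal.ofReal_pow (norm_nonneg _)]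
  refine ENNReal.ofReal_le_ofReal ?_
  have h1 : (1 : ℝ) ≤ 1 + ‖ξ‖ ^ 2 := le_add_of_nonneg_right (sq_nonneg _)
  calc ‖ξ‖ ^ 2 ≤ 1 + ‖ξ‖ ^ 2 := (le_add_of_nonneg_left zero_le_one)
    _ ≤ (1 + ‖ξ‖ ^ 2) ^ (10 : ℝ) := Real.self_le_rpow_of_one_le h1 (by norm_num)

/-- Plancherel for the representative: `(∫ |ŵ|²)^{1/2} = ‖w‖_{L²}`. [folklore] -/
theorem lintegral_enorm_sq_fourierFn_rpow_eq (w : L2C) :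
    (∫⁻ ξ, ‖fourierFn w ξ‖ₑ ^ 2) ^ (1 / 2 : ℝ) = ‖w‖ₑ := by
  have h := eLpNorm_eq_lintegral_rpow_enorm_toReal (f := fourierFn w) (μ := volume) (p := 2)
    two_ne_zero ENNReal.ofNat_ne_top
  simp only [ENNReal.toReal_ofNat, ENNReal.rpow_two] at h
  rw [← h, fourierFn, ← Lp.enorm_def, ← ofReal_norm, ← ofReal_norm, Lp.norm_fourier_eq]

/-- **Absolute convergence of (1.3)** in the accepted setting: for `u, v ∈ L²` with finite `H¹⁰`
norm and any `w ∈ L²`,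
`∫∫ |Λ(û(ξ₁), v̂(ξ₂), ŵ(-ξ₁-ξ₂))| dξ₁dξ₂ ≤ 2 C ‖u‖_{H¹⁰} ‖v‖_{H¹⁰} ‖w‖_{L²}`,
`C = (∫ (1+|ξ|²)^{-10})^{1/2}` (Tao, p. 3: (1.3) holds "for all `u, v, w ∈ H¹⁰_df`"; p. 7). [cite: Tao2016AveragedNS, §1.1 (1.3) p. 3] -/
theorem lintegral_enorm_Λ_fourierFn_le (u v w : L2C) :
    ∫⁻ p : EuclideanSpace ℝ (Fin 3) × EuclideanSpace ℝ (Fin 3),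
        ‖Λ p.1 p.2 (fourierFn u p.1) (fourierFn v p.2) (fourierFn w (-p.1 - p.2))‖ₑ ≤
      2 * (∫⁻ ξ : EuclideanSpace ℝ (Fin 3), ENNReal.ofReal ((1 + ‖ξ‖ ^ 2) ^ (-10 : ℝ))) ^ (1 / 2 : ℝ) *
        FunctionSpaces.eFourierSobolevNorm 10 u * FunctionSpaces.eFourierSobolevNorm 10 v * ‖w‖ₑ := by
  set C : ℝ≥0∞ := (∫⁻ ξ : EuclideanSpace ℝ (Fin 3), ENNReal.ofReal ((1 + ‖ξ‖ ^ 2) ^ (-10 : ℝ))) ^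
    (1 / 2 : ℝ) with hC
  have hu := lintegral_enorm_le_sobolevWeight (f := fourierFn u) (Lp.aestronglyMeasurable (𝓕 u : L2C))
  have hv := lintegral_enorm_le_sobolevWeight (f := fourierFn v) (Lp.aestronglyMeasurable (𝓕 v : L2C))
  have hu' := lintegral_sq_enorm_mul_rpow_le (fourierFn u)
  have hv' := lintegral_sq_enorm_mul_rpow_le (fourierFn v)
  rw [← hC] at hu hv
  rw [← eFourierSobolevNorm_eq] at hu hv hu' hv'
  refine (lintegral_enorm_Λ_le (f := fourierFn u) (g := fourierFn v) (h := fourierFn w)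
    (Lp.aestronglyMeasurable (𝓕 u : L2C)) (Lp.aestronglyMeasurable (𝓕 v : L2C))
    (Lp.aestronglyMeasurable (𝓕 w : L2C))).trans ?_
  rw [lintegral_enorm_sq_fourierFn_rpow_eq]
  refine mul_le_mul' ?_ le_rfl
  calc (∫⁻ ξ, ‖fourierFn u ξ‖ₑ) * (∫⁻ ξ, (‖ξ‖ₑ * ‖fourierFn v ξ‖ₑ) ^ 2) ^ (1 / 2 : ℝ) +
        (∫⁻ ξ, ‖fourierFn v ξ‖ₑ) * (∫⁻ ξ, (‖ξ‖ₑ * ‖fourierFn u ξ‖ₑ) ^ 2) ^ (1 / 2 : ℝ)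
      ≤ C * FunctionSpaces.eFourierSobolevNorm 10 u * FunctionSpaces.eFourierSobolevNorm 10 v +
        C * FunctionSpaces.eFourierSobolevNorm 10 v * FunctionSpaces.eFourierSobolevNorm 10 u :=
        add_le_add (mul_le_mul' hu hv') (mul_le_mul' hv hu')
    _ = 2 * C * FunctionSpaces.eFourierSobolevNorm 10 u * FunctionSpaces.eFourierSobolevNorm 10 v := by
        ring

/-- **The Euler integrand is integrable for `u, v ∈ H¹⁰`, `w ∈ L²`** (absolute convergence of
(1.3), Tao p. 3/p. 7), so that `eulerForm u v w` is a genuine (junk-free) integral there. [cite: Tao2016AveragedNS, §1.1 (1.3) p. 3] -/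
theorem integrable_Λ_fourierFn {u v : L2C} (w : L2C)
    (hu : FunctionSpaces.eFourierSobolevNorm 10 u < ∞) (hv : FunctionSpaces.eFourierSobolevNorm 10 v < ∞) :
    Integrable (fun p : EuclideanSpace ℝ (Fin 3) × EuclideanSpace ℝ (Fin 3) =>
      Λ p.1 p.2 (fourierFn u p.1) (fourierFn v p.2) (fourierFn w (-p.1 - p.2))) := by
  refine ⟨aestronglyMeasurable_Λ_comp (Lp.aestronglyMeasurable (𝓕 u : L2C))
    (Lp.aestronglyMeasurable (𝓕 v : L2C)) (Lp.aestronglyMeasurable (𝓕 w : L2C)), ?_⟩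
  refine lt_of_le_of_lt (lintegral_enorm_Λ_fourierFn_le u v w) ?_
  refine ENNReal.mul_lt_top (ENNReal.mul_lt_top (ENNReal.mul_lt_top (ENNReal.mul_lt_top
    ENNReal.ofNat_lt_top ?_) hu) hv) enorm_lt_top
  exact ENNReal.rpow_lt_top_of_nonneg (by norm_num) lintegral_inv_sobolevWeight_lt_top.ne

/-- **`⟨B(u,v), ·⟩` is `ℂ`-linear on `L²` for `u, v ∈ H¹⁰`**:
`⟨B(u,v), a w₁ + b w₂⟩ = a ⟨B(u,v), w₁⟩ + b ⟨B(u,v), w₂⟩` (Tao, p. 3: `B(u,v) ∈ (H¹⁰_df)*`, indeed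
in `L²`). [cite: Tao2016AveragedNS, §1.1 (1.3) p. 3] -/
theorem eulerForm_add_smul_right_of_sobolev {u v : L2C} (w₁ w₂ : L2C) (a b : ℂ)
    (hu : FunctionSpaces.eFourierSobolevNorm 10 u < ∞) (hv : FunctionSpaces.eFourierSobolevNorm 10 v < ∞) :
    eulerForm u v (a • w₁ + b • w₂) = a * eulerForm u v w₁ + b * eulerForm u v w₂ :=
  eulerForm_add_smul_right a b (integrable_Λ_fourierFn w₁ hu hv) (integrable_Λ_fourierFn w₂ hu hv)

/-- **The Euler form is bounded on `H¹⁰ × H¹⁰ × L²`**: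
`|⟨B(u,v), w⟩| ≤ 2π C ‖u‖_{H¹⁰} ‖v‖_{H¹⁰} ‖w‖_{L²}` (the bound behind "`B(u,v)` takes values in
`L²`", Tao p. 3, in the crude form needed for the absolute convergence of (1.13)). [cite: Tao2016AveragedNS, §1.1 (1.3) p. 3] -/
theorem enorm_eulerForm_le (u v w : L2C) :
    ‖eulerForm u v w‖ₑ ≤ ENNReal.ofReal Real.pi *
      (2 * (∫⁻ ξ : EuclideanSpace ℝ (Fin 3), ENNReal.ofReal ((1 + ‖ξ‖ ^ 2) ^ (-10 : ℝ))) ^ (1 / 2 : ℝ) *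
        FunctionSpaces.eFourierSobolevNorm 10 u * FunctionSpaces.eFourierSobolevNorm 10 v * ‖w‖ₑ) := by
  have hπ : ‖-((Real.pi : ℂ) * I)‖ₑ = ENNReal.ofReal Real.pi := by
    rw [enorm_neg, enorm_mul, ← ofReal_norm, ← ofReal_norm, Complex.norm_I, ENNReal.ofReal_one,
      mul_one, Complex.norm_real, Real.norm_of_nonneg Real.pi_pos.le]
  unfold eulerForm
  rw [enorm_mul, hπ]
  exact mul_le_mul' le_rfl ((enorm_integral_le_lintegral_enorm _).trans
    (lintegral_enorm_Λ_fourierFn_le u v w))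

end Literature.Analysis.FluidPDE.Tao2016
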